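import Mathlib
import HarnessLib
import Summits.FinalStateConjecture.FinalStateConjecture.Theorems.ZeroEnergyKerrOrBombKerrModeStabilityData
import Summits.FinalStateConjecture.FinalStateConjecture.Theorems.ZeroEnergyKerrOrBombKerrModeStabilityLocalUniqueness

/-!
# Route ZeroEnergyKerrOrBomb · item `KerrModeStability` — the truncated solutions

Helper file for item stmt-FinalStateConjecture-10024 (`KerrModeStability`). Given the pair
`(ψ, χ)` of the item on a horizon-penetrating chart and a radius `R₀ > 0`, the Cauchy-problem fact
`KerrSchild.waveCauchyProblem` (through `Kerr.exists_wave_of_data`) launches from the truncated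
data of `KerrModeData` a smooth solution `ψ_t` of `□_g ψ_t = 0` on the whole chart whose data on
the leaf `{t* = 0}`: vanish beyond `‖y‖ = R₀ + 1` (so that the leaf-energy boundedness
`kerr_leafEnergy_boundedness_of` applies to it), agree with those of `ψ` on the exterior part of
`{‖y‖ ≤ R₀}` (so that local uniqueness identifies `ψ_t` with `ψ` inside the domain of dependence),
and have coordinate energy density bounded by twice that of `ψ` plus a zeroth-order term controlled
by `|ψ|, |χ|` (`kerrMode_truncatedSolution_exists`). No new definitions.
-/

noncomputable section

namespace Summit.FinalStateConjecture.FinalStateConjecture.Theorems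

open Literature.Geometry.Lorentzian Set Filter
open scoped Manifold ContDiff Topology

-- every `Summit.FinalStateConjecture.FinalStateConjecture.…` name repeats the summit = sub-problem segment (D-0017 layout)
set_option linter.dupNamespace false

/-- Four real squares: `(a + b)² ≤ 2a² + 2b²`. -/
theorem kerr_sq_add_le (a b : ℝ) : (a + b) ^ 2 ≤ 2 * a ^ 2 + 2 * b ^ 2 := by
  nlinarith [sq_nonneg (a - b)]

/-- **The truncated solution.** Let `(M, a)` be subextremal, `r₋ < r₀ < r₊`, `ψ, χ` smooth on
`Kerr.region a r₀` with `∂_{t*} ψ = νψ − ωχ` on `{r > r₊}`, `R₀ > 0`, `K` a bound for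
`|smoothTransition'|`, and assume the Cauchy-problem fact `KerrSchild.waveCauchyProblem`. Then there
is a smooth `ψ_t : Kerr.region a r₀ → ℝ` with `□_g ψ_t = 0` on the whole chart such that, writing
`ψ̃_t, ψ̃, χ̃` for the extensions by zero: (i) the data of `ψ_t` on `{t* = 0}` vanish at all points
with `‖x⃗‖ > R₀ + 1`; (ii) `ψ̃_t(0, y) = ψ̃(0, y)` and `∂_{t*}ψ̃_t(0, y) = ∂_{t*}ψ̃(0, y)` at exterior
slice points with `‖y‖ ≤ R₀`; (iii) at every exterior slice point,
`e[ψ_t](0, y) ≤ 2 e[ψ](0, y) + 6K² ψ̃(0,y)² + (|ν||ψ̃(0,y)| + |ω||χ̃(0,y)|)²` for the coordinate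
energy densities; (iv) `e[ψ_t](0, y) = 0` for `‖y‖ > R₀ + 1`. Proof: `Kerr.exists_wave_of_data`
with the data of `kerrMode_data_exists`; the full differential on the leaf is read off from the
data (`kerr_fderiv_comp_ofTimeSpace_single`, `OpensChart.mfderiv_eq`). -/
theorem kerrMode_truncatedSolution_exists [Kerr.Facts] [Kerr.SliceFacts]
    (hwcp : KerrSchild.waveCauchyProblem) {M a r₀ : ℝ} (hMa : Kerr.IsSubextremal M a)
    (hrm : Kerr.rMinus M a < r₀) (hr : r₀ < Kerr.rPlus M a) {ψ χ : Kerr.region a r₀ → ℝ}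
    (hψ : ContMDiff 𝓘(ℝ, E4) 𝓘(ℝ, ℝ) ∞ ψ) (hχ : ContMDiff 𝓘(ℝ, E4) 𝓘(ℝ, ℝ) ∞ χ) {ν w : ℝ}
    (heig : ∀ x : Kerr.region a r₀, Kerr.rPlus M a < Kerr.radius a x.1 →
      mfderiv 𝓘(ℝ, E4) 𝓘(ℝ, ℝ) ψ x (Kerr.stationaryField a r₀ x) = ν * ψ x - w * χ x)
    {R₀ K : ℝ} (hR₀ : 0 < R₀) (hK : ∀ t, |deriv Real.smoothTransition t| ≤ K) :
    ∃ ψt : Kerr.region a r₀ → ℝ, ContMDiff 𝓘(ℝ, E4) 𝓘(ℝ, ℝ) ∞ ψt ∧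
      (∀ x, (Kerr.smoothMetric M a r₀).toPseudoRiemannianMetric.dalembertian ψt x = 0) ∧
      (∃ ρ : ℝ, ∀ x : Kerr.region a r₀, (x : E4) 0 = 0 → ρ < E4.spatialNorm (x : E4) →
          ψt x = 0 ∧ mfderiv 𝓘(ℝ, E4) 𝓘(ℝ, ℝ) ψt x = 0) ∧
      (∀ y : E3, Kerr.rPlus M a < Kerr.radius a (E4.ofTimeSpace 0 y) → ‖y‖ ≤ R₀ →
        Function.extend Subtype.val ψt 0 (E4.ofTimeSpace 0 y) =
            Function.extend Subtype.val ψ 0 (E4.ofTimeSpace 0 y) ∧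
          fderiv ℝ (Function.extend Subtype.val ψt 0) (E4.ofTimeSpace 0 y) (E4.basisVector 0) =
            fderiv ℝ (Function.extend Subtype.val ψ 0) (E4.ofTimeSpace 0 y) (E4.basisVector 0)) ∧
      (∀ y : E3, Kerr.rPlus M a < Kerr.radius a (E4.ofTimeSpace 0 y) →
        coordEnergyDensity (Kerr.region a r₀) ψt (E4.ofTimeSpace 0 y) ≤
          2 * coordEnergyDensity (Kerr.region a r₀) ψ (E4.ofTimeSpace 0 y) +
            (6 * K ^ 2 * (Function.extend Subtype.val ψ 0 (E4.ofTimeSpace 0 y)) ^ 2 +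
              (|ν| * |Function.extend Subtype.val ψ 0 (E4.ofTimeSpace 0 y)| +
                |w| * |Function.extend Subtype.val χ 0 (E4.ofTimeSpace 0 y)|) ^ 2)) ∧
      (∀ y : E3, R₀ + 1 < ‖y‖ → E4.ofTimeSpace 0 y ∈ Kerr.region a r₀ →
        coordEnergyDensity (Kerr.region a r₀) ψt (E4.ofTimeSpace 0 y) = 0) := by
  have hM : 0 < M := hMa.pos
  have hr₀0 : 0 < r₀ := hMa.rMinus_nonneg.trans_lt hrm
  set rp := Kerr.rPlus M a with hrp_def
  set Φ : E4 → ℝ := Function.extend Subtype.val ψ 0 with hΦ_def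
  set X : E4 → ℝ := Function.extend Subtype.val χ 0 with hX_def
  -- the data and the solution
  obtain ⟨d₀, d₁, hd₀, hd₁, hc₀, hc₁, hfar, hagree, hbounds⟩ :=
    kerrMode_data_exists hMa hrm hr hψ hχ ν w hR₀ hK
  obtain ⟨ψt, hψt, hsolt, hdata, -⟩ := Kerr.exists_wave_of_data hwcp hM.le a hr₀0 hd₀ hd₁ hc₀ hc₁
  set Ψ : E4 → ℝ := Function.extend Subtype.val ψt 0 with hΨ_def
  have hrepΨ : ∀ z : Kerr.region a r₀, ψt z = Ψ z := extend_rep ψt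
  have hΨs : ∀ z : Kerr.region a r₀, ContDiffAt ℝ ∞ Ψ z := fun z ↦ contDiffAt_extend hψt z
  have hΨd : ∀ z : Kerr.region a r₀, DifferentiableAt ℝ Ψ z := fun z ↦
    (hΨs z).differentiableAt (by simp)
  -- membership of slice points
  have hext_reg : ∀ y : E3, rp < Kerr.radius a (E4.ofTimeSpace 0 y) →
      E4.ofTimeSpace 0 y ∈ Kerr.region a r₀ := fun y hy ↦
    kerr_mem_region_of_rPlus_lt hMa hr.le hy
  -- the data of `ψt` in terms of `Ψ`, at slice points of the chart
  have hval : ∀ y : E3, ∀ hy : E4.ofTimeSpace 0 y ∈ Kerr.region a r₀,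
      Ψ (E4.ofTimeSpace 0 y) = d₀ y := by
    intro y hy
    have h := (hdata ⟨E4.ofTimeSpace 0 y, hy⟩ (by simp)).1
    rw [hrepΨ] at h
    simpa using h
  have htime : ∀ y : E3, ∀ hy : E4.ofTimeSpace 0 y ∈ Kerr.region a r₀,
      fderiv ℝ Ψ (E4.ofTimeSpace 0 y) (E4.basisVector 0) = d₁ y := by
    intro y hy
    have h := (hdata ⟨E4.ofTimeSpace 0 y, hy⟩ (by simp)).2
    rw [OpensChart.mfderiv_eq _ ψt Ψ hrepΨ (hΨd ⟨_, hy⟩)] at h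
    have h' : fderiv ℝ Ψ (E4.ofTimeSpace 0 y) (E4.basisVector 0) =
        d₁ (E4.spatial (E4.ofTimeSpace 0 y)) := h
    rw [E4.spatial_ofTimeSpace] at h'
    exact h'
  -- the tangential derivatives: `y' ↦ Ψ(0, y')` agrees with `d₀` near slice points of the chart
  have hopen : IsOpen {y' : E3 | E4.ofTimeSpace 0 y' ∈ Kerr.region a r₀} :=
    (Kerr.region a r₀).isOpen.preimage (E4.continuous_ofTimeSpace 0)
  have htan : ∀ y : E3, ∀ hy : E4.ofTimeSpace 0 y ∈ Kerr.region a r₀, ∀ i : Fin 3,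
      fderiv ℝ Ψ (E4.ofTimeSpace 0 y) (E4.basisVector i.succ) =
        fderiv ℝ d₀ y (EuclideanSpace.single i 1) := by
    intro y hy i
    have hev : (fun y' ↦ Ψ (E4.ofTimeSpace 0 y')) =ᶠ[𝓝 y] d₀ := by
      filter_upwards [hopen.mem_nhds hy] with y' hy'
      exact hval y' hy'
    rw [← kerr_fderiv_comp_ofTimeSpace_single (hΨd ⟨_, hy⟩) i, hev.fderiv_eq]
  -- the coordinate energy density of `ψt` on the leaf, in terms of the data
  have hced : ∀ y : E3, ∀ hy : E4.ofTimeSpace 0 y ∈ Kerr.region a r₀,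
      coordEnergyDensity (Kerr.region a r₀) ψt (E4.ofTimeSpace 0 y) =
        (d₁ y) ^ 2 + ∑ i : Fin 3, (fderiv ℝ d₀ y (EuclideanSpace.single i 1)) ^ 2 := by
    intro y hy
    simp only [coordEnergyDensity, Fin.sum_univ_succ (n := 3)]
    congr 1
    · rw [← htime y hy]
    · simp only [Fin.sum_univ_three]
      rw [← htan y hy 0, ← htan y hy 1, ← htan y hy 2]
  refine ⟨ψt, hψt, hsolt, ⟨R₀ + 1, fun x hx0 hxρ ↦ ?_⟩, fun y hy hyR ↦ ?_, fun y hy ↦ ?_,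
    fun y hy hyreg ↦ ?_⟩
  · -- (i) the data vanish beyond `R₀ + 1`
    set y : E3 := E4.spatial (x : E4) with hy_def
    have hxeq : (x : E4) = E4.ofTimeSpace 0 y := by
      conv_lhs => rw [← E4.ofTimeSpace_time_spatial (x : E4)]
      rw [E4.time_apply, hx0]
    have hxreg : E4.ofTimeSpace 0 y ∈ Kerr.region a r₀ := by rw [← hxeq]; exact x.2
    have hsn : E4.spatialNorm (x : E4) = ‖y‖ := rfl
    rw [hsn] at hxρ
    have hv : ψt x = 0 := by
      rw [hrepΨ x, hxeq, hval y hxreg]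
      exact (hfar y hxρ.le).1
    refine ⟨hv, ?_⟩
    -- the differential: tangential part from `d₀ = 0` on the open set `{‖y‖ > R₀ + 1}`, time part `d₁`
    rw [OpensChart.mfderiv_eq x ψt Ψ hrepΨ (hΨd x), hxeq]
    have hO : IsOpen {y' : E3 | E4.ofTimeSpace 0 y' ∈ Kerr.region a r₀ ∧ R₀ + 1 < ‖y'‖} :=
      hopen.inter (isOpen_lt continuous_const continuous_norm)
    have hzero : fderiv ℝ (fun _ : E4 ↦ (0 : ℝ)) (E4.ofTimeSpace 0 y) = 0 := by simp
    have key : fderiv ℝ Ψ (E4.ofTimeSpace 0 y) =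
        fderiv ℝ (fun _ : E4 ↦ (0 : ℝ)) (E4.ofTimeSpace 0 y) := by
      refine kerr_fderiv_eq_of_data_eqOn (F := Ψ) (G := fun _ : E4 ↦ (0 : ℝ)) hO ⟨hxreg, hxρ⟩
        (hΨd ⟨_, hxreg⟩) (differentiableAt_const _) (fun y' hy' ↦ ?_) ?_
      · show Ψ (E4.ofTimeSpace 0 y') = 0
        rw [hval y' hy'.1]; exact (hfar y' hy'.2.le).1
      · rw [htime y hxreg, hzero]; exact (hfar y hxρ.le).2
    rw [key, hzero]
    rfl
  · -- (ii) agreement with the data of `ψ` on the exterior part of the ball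
    have hyreg := hext_reg y hy
    obtain ⟨h0, h1⟩ := hagree y hy hyR
    rw [← hΨ_def]
    refine ⟨by rw [hval y hyreg, h0], ?_⟩
    rw [htime y hyreg, h1]
    have h := heig ⟨E4.ofTimeSpace 0 y, hyreg⟩ hy
    have hΦd : DifferentiableAt ℝ Φ (E4.ofTimeSpace 0 y) :=
      (contDiffAt_extend hψ ⟨_, hyreg⟩).differentiableAt (by simp)
    rw [OpensChart.mfderiv_eq _ ψ Φ (extend_rep ψ) hΦd, extend_rep ψ, extend_rep χ] at h
    exact h.symm
  · -- (iii) the energy density bound at exterior slice points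
    have hyreg := hext_reg y hy
    obtain ⟨-, hb1, hbd⟩ := hbounds y hy
    rw [hced y hyreg]
    have hterm : ∀ i : Fin 3, (fderiv ℝ d₀ y (EuclideanSpace.single i 1)) ^ 2 ≤
        2 * (fderiv ℝ Φ (E4.ofTimeSpace 0 y) (E4.basisVector i.succ)) ^ 2 +
          2 * (K * |Φ (E4.ofTimeSpace 0 y)|) ^ 2 := by
      intro i
      have h := hbd i
      have hsq : (fderiv ℝ d₀ y (EuclideanSpace.single i 1)) ^ 2 ≤
          (|fderiv ℝ Φ (E4.ofTimeSpace 0 y) (E4.basisVector i.succ)| +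
            K * |Φ (E4.ofTimeSpace 0 y)|) ^ 2 := by
        rw [← sq_abs (fderiv ℝ d₀ y _)]
        exact pow_le_pow_left₀ (abs_nonneg _) h 2
      refine hsq.trans ?_
      have := kerr_sq_add_le |fderiv ℝ Φ (E4.ofTimeSpace 0 y) (E4.basisVector i.succ)|
        (K * |Φ (E4.ofTimeSpace 0 y)|)
      rwa [sq_abs] at this
    have hsum : ∑ i : Fin 3, (fderiv ℝ d₀ y (EuclideanSpace.single i 1)) ^ 2 ≤
        2 * ∑ i : Fin 3, (fderiv ℝ Φ (E4.ofTimeSpace 0 y) (E4.basisVector i.succ)) ^ 2 +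
          6 * K ^ 2 * (Φ (E4.ofTimeSpace 0 y)) ^ 2 := by
      calc ∑ i : Fin 3, (fderiv ℝ d₀ y (EuclideanSpace.single i 1)) ^ 2
          ≤ ∑ i : Fin 3, (2 * (fderiv ℝ Φ (E4.ofTimeSpace 0 y) (E4.basisVector i.succ)) ^ 2 +
              2 * (K * |Φ (E4.ofTimeSpace 0 y)|) ^ 2) := Finset.sum_le_sum fun i _ ↦ hterm i
        _ = 2 * ∑ i : Fin 3, (fderiv ℝ Φ (E4.ofTimeSpace 0 y) (E4.basisVector i.succ)) ^ 2 +
              6 * K ^ 2 * (Φ (E4.ofTimeSpace 0 y)) ^ 2 := by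
            rw [Finset.sum_add_distrib, Finset.mul_sum, Finset.sum_const, Finset.card_univ,
              Fintype.card_fin, mul_pow, sq_abs]
            simp only [nsmul_eq_mul, Nat.cast_ofNat]
            ring
    have hd1sq : (d₁ y) ^ 2 ≤ (|ν| * |Φ (E4.ofTimeSpace 0 y)| + |w| * |X (E4.ofTimeSpace 0 y)|) ^ 2 := by
      rw [← sq_abs (d₁ y)]
      exact pow_le_pow_left₀ (abs_nonneg _) hb1 2
    have hcedψ : 2 * ∑ i : Fin 3, (fderiv ℝ Φ (E4.ofTimeSpace 0 y) (E4.basisVector i.succ)) ^ 2 ≤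
        2 * coordEnergyDensity (Kerr.region a r₀) ψ (E4.ofTimeSpace 0 y) := by
      refine mul_le_mul_of_nonneg_left ?_ (by norm_num)
      simp only [coordEnergyDensity, Fin.sum_univ_succ (n := 3)]
      have h0 : 0 ≤ (fderiv ℝ (Function.extend Subtype.val ψ 0) (E4.ofTimeSpace 0 y)
          (EuclideanSpace.single (0 : Fin 4) 1)) ^ 2 := sq_nonneg _
      linarith
    linarith
  · -- (iv) the energy density vanishes beyond `R₀ + 1`
    rw [hced y hyreg]
    have hO : IsOpen {y' : E3 | R₀ + 1 < ‖y'‖} := isOpen_lt continuous_const continuous_norm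
    have hd0 : fderiv ℝ d₀ y = 0 := by
      have hev : d₀ =ᶠ[𝓝 y] fun _ ↦ 0 :=
        Filter.eventually_of_mem (hO.mem_nhds hy) fun y' hy' ↦ (hfar y' (le_of_lt hy')).1
      rw [hev.fderiv_eq]; simp
    simp [hd0, (hfar y hy.le).2]

end Summit.FinalStateConjecture.FinalStateConjecture.Theorems

end
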